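import Literature.NumberTheory.EllipticCurves.SerreOpenImageDeterminantProofs
import Mathlib.NumberTheory.DirichletCharacter.Basic
import HarnessLib

/-!
# X11 at `p = 3`: the PRINTED prime thresholds of the four `p ‖ N` sources, and the two that are arithmetic (cell `b2b-bsdres`, team `x11b3`, seat LITERATURE 2)

HONEST FRAMING (run/shared/lean/b2b/bsd-rank1-residual/, verbatim): the goal of the cell is to
DELETE the COMBINATION-SHAPED residual classes for ALL analytic-rank `≤ 1` elliptic curves over `ℚ`
— "full BSD formula for every rank `≤ 1` curve in class C" assembled STRICTLY from published
theorems — so that the rank-`≤ 1` remainder becomes exactly the CONSTRUCTION-SHAPED classes, which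
are TYPED (missing-input `Prop`s), NOT attempted. This is not "finishing BSD". Team `x11b3` works
the construction-shaped clause X11 ∧ `p = 3` ∧ `r = 1` (`IsX11Three`: `3 ‖ N`, `E[3]` irreducible,
`ord_{s=1} L(E,s) = 1`; typed missing input `Typed.X11Three.MissingInputAt`); research route, no
claim beyond the stated class. THEOREMS ONLY: this file defines nothing and states no named fact.

## What the four sources of the seat PRINT about the prime (read at the page, 2026-08-21)

* Bertolini–Darmon–Prasanna, Duke Math. J. 162 (2013) 1033–1148 [BertoliniDarmonPrasanna2013],
  Assumption 5.12 (authors' file `51.BDP1/paper.pdf`, §5.3, p. 62): "(1) The form `f` is a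
  normalised cuspidal eigenform in `S_k(Γ₀(N), ε_f)`. (2) `c` is an odd rational integer prime to
  `N d_K`. (3) The quadratic imaginary field `K` has odd discriminant and satisfies the Heegner
  hypothesis stated in Assumption 1.9 … (5) The rational prime `(p) = 𝔭𝔭̄` is split in `K/ℚ` and
  prime to `Nc`." (running assumption `N > 4`, §1.1/§2.1). NO lower bound on `p`: Thm. 5.13 holds
  at `p = 3` whenever `3 ∤ Nc` splits in `K` — and NEVER on X11 at `3` (`3 ∣ N`; tree
  `IsX11Three.not_hasGoodReductionAtPrime`). Its `p ‖ N` analogue, Castella, J. Inst. Math.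
  Jussieu 17 (2018) Thm. 2.11 [Castella2018Exceptional] ("extends the `p`-adic Gross–Zagier
  formula of [bdp1] to the semistable non-crystalline setting"), stands under §1 "Fix a prime
  `p ≥ 5`" and §2 "Let `E_{p−1}` be the normalized Eisenstein series of weight `p−1` (recall that
  `p ≥ 5`)" (arXiv:1507.04260, pp. 1, 4) — the ordinary locus of `X₁(N)` is cut out by `E_{p−1}`.
* Skinner–Zhang, arXiv:1407.1099v1 (2014; v1 only, UNREFEREED) [SkinnerZhang2014], §2.1 (p. 3):
  "Throughout, `p ≥ 5` is a fixed prime." Two uses are ARITHMETIC, not conventions: Hypothesis ♣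
  (§2.5, p. 4) "(2) the image of `ρ̄ : G_ℚ → Aut_{k₀} V₀ ≅ GL₂(k₀)` contains a non-trivial unipotent
  element and at least two elements conjugate, respectively, to matrices of the form `diag[a,1]`
  and `diag[b,−1]`, with `a, b ∈ 𝔽_p^× ∖ {±1}`. Note that in order for part (2) of this hypothesis
  to hold, `p` must be at least `5`." (`hyp_club2_candidates_empty_at_three` below: `𝔽₃^× = {±1}`);
  and the proof of Lemma 5.5 (multiplicity one, p. 13): "since `p ≥ 5`, (a) implies that `𝔪₀` is
  not contained in the set denoted `S` in [Helm] (as this set consists exactly of those maximal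
  ideals `𝔪` such that either … `ρ̄_𝔪` is reducible or for which `p = 2` or `3`)". The other uses
  (Rem. 2.8: (4) of ♥ automatic for elliptic curves via [W. Zhang 2014]; Thm. 9.11: "`w_K/2 ∈ ℤ_p^×`
  (as `p ≥ 5`)"; §12.1: "Since `p ≥ 5`, … part (2) of ♣ also holds") are listed in the seat report.
* Fouquet–Wan, arXiv:2107.13726 (v3, 8 Apr 2022; UNREFEREED) [FouquetWan2021]: abstract "Let `p`
  be an odd prime"; Thm. 4.41 (the statement Castella's erratum invokes for the divisibility (2.4))
  is about an eigencuspform with `ρ_f|_{G_{ℚ_p}}` CRYSTALLINE (so `p ∤` level), ordinary or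
  residually `p`-irreducible, `ρ̄_f|_{G_𝒦}` absolutely irreducible, a `q ‖ N` nonsplit in `𝒦`;
  no `p ≥ 5` is printed there. But the paper's standing Assumption 2.1 (HypTW) (§2.2.2), verbatim:
  "If `ρ̄|_{G_{ℚ_p}}` is an extension `0 → χ₁ → ρ̄|_{G_{ℚ_p}} → χ₂ → 0`, then `χ₁⁻¹χ₂ ∉ {1, χ̄_cyc}`",
  and its main Thm. 5.1 requires "The semisimplification of `ρ̄_f|_{G_{ℚ_p}}` is not equal to
  `χ̄ ⊕ χ̄_cyc χ̄`". For `E/ℚ` MULTIPLICATIVE at `p`, Tate's uniformisation gives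
  `0 → ψ̄χ̄_cyc → E[p]|_{G_{ℚ_p}} → ψ̄ → 0` (`ψ` unramified, `ψ² = 1`), so `χ₁⁻¹χ₂ = χ̄_cyc⁻¹`: at
  `p ≥ 5` this is `∉ {1, χ̄_cyc}`; AT `p = 3` the mod-`3` cyclotomic character takes values in
  `𝔽₃^× = {±1}` and equals its own inverse (`modPCyclotomicCharacterZMod_three_inv_eq_self` below,
  for every field of characteristic `≠ 3`, in particular `ℚ` and `ℚ₃`), so (HypTW) FAILS for every
  curve with multiplicative reduction at `3`; and Thm. 5.1's local hypothesis fails at EVERY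
  multiplicative prime (`(E[p]|_{G_{ℚ_p}})^{ss} = ψ̄ ⊕ ψ̄χ̄_cyc`), which is why the erratum goes
  through the crystalline higher-weight members of the Hida family (Thm. 4.41) and not Thm. 5.1.
* Skinner, Pacific J. Math. 283 (2016) Thm. C [Skinner2016PacificMC] (tree fact
  `Skinner2016.thmC_padicValRat_bsd_rank_zero`): "good ordinary or multiplicative reduction at a
  prime `p ≥ 3`" — `p = 3` INCLUDED as printed (integrality at `3` by footnote 1 and §2.5: (irr) +
  the ramified `q ‖ N` replace Kato's `SL₂(ℤ_p)`-image hypothesis); rank `0` only; no "`p ≥ 5`"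
  anywhere in the paper (checked: arXiv:1407.1093 pp. 1–15).

So of the thresholds that keep the announced `p ‖ N` rank-one architecture away from `p = 3`, two
are ARITHMETIC IDENTITIES at `3` (not conventions a careful re-reading could lift): `𝔽₃^× ∖ {±1} = ∅`
(Skinner–Zhang ♣(2): no Kolyvagin primes with the prescribed Frobenius) and `χ̄₃ = χ̄₃⁻¹`
(Fouquet–Wan (HypTW) at a multiplicative `3`). The kernel content of this file is exactly these two
identities and their failure at `p ≥ 5`; the dictionary to the sources is the docstrings. Nothing
here is a statement about elliptic curves, and nothing changes the cell's label of X11 ∧ `p = 3`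
(CONSTRUCTION-SHAPED, REFEREE.md R6.2). Seat report: HOME/cells/x11b3/LIT2-SOURCES.md.

APPENDED (seat LITERATURE 2, gen 3, 2026-08-21): a THIRD arithmetic threshold of the same kind, one
level deeper in the chain the erratum's divisibility (2.4) rests on — Eischen–Wan, J. Inst. Math.
Jussieu 15 (2016) [EischenWan2016] (= Fouquet–Wan's Prop. 7.19, the two-variable Klingen–Eisenstein
family and `p`-adic `L`-function for a form UNRAMIFIED at `p`) computes at `p` only under the tame
datum "`τ₁, τ₂, τ₁τ₂` all have conductor `(p)`" (§4.3, Prop. 4.8, §4.3.2, and the interpolation set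
`𝒳^{pb}` of §5.1), which needs two non-trivial characters of `𝔽_p^×` with non-trivial product:
impossible at `p = 3` (`mulChar_zmod_three_mul_eq_one_of_ne_one`,
`not_exists_dirichletCharacter_three_conductor_pair`), available at every `p ≥ 5`
(`exists_dirichletCharacter_conductor_pair_of_five_le`). See the section docstring below and
HOME/b2b-bsdres-x11b3-lit2/LIT-TABLE-K.md §11.
-/

namespace Literature.NumberTheory.EllipticCurves.Rank1Residual.X11Three

open Literature.NumberTheory.GaloisRepresentations Field

/-! ### `𝔽₃^× = {±1}`: Skinner–Zhang's Hypothesis ♣ (2) has no candidates at `p = 3` -/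

/-- The units of `𝔽₃` are `±1`. [folklore] -/
private theorem units_zmod_three_eq_one_or_eq_neg_one (u : (ZMod 3)ˣ) : u = 1 ∨ u = -1 := by
  revert u
  decide

/-- **Skinner–Zhang, Hypothesis ♣ (2) is void at `p = 3`.** The hypothesis asks for image elements
conjugate to `diag[a,1]`, `diag[b,−1]` with `a, b ∈ 𝔽_p^× ∖ {±1}`; at `p = 3` that set is empty —
the authors' own remark "in order for part (2) of this hypothesis to hold, `p` must be at least
`5`". Group-theoretic core only (no Galois representation is mentioned).
[cite: SkinnerZhang2014, §2.5 Hypothesis ♣ (2) and the sentence following it (arXiv:1407.1099v1 p. 4)] -/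
theorem hyp_club2_candidates_empty_at_three : ¬ ∃ u : (ZMod 3)ˣ, u ≠ 1 ∧ u ≠ -1 := by
  rintro ⟨u, h1, h2⟩
  rcases units_zmod_three_eq_one_or_eq_neg_one u with h | h
  · exact h1 h
  · exact h2 h

/-- Contrast: for a prime `p ≥ 5` the set `𝔽_p^× ∖ {±1}` is non-empty (`2` is such a unit), so
Hypothesis ♣ (2) is a genuine condition on the image there, not an arithmetic impossibility.
[cite: SkinnerZhang2014, §2.5 Hypothesis ♣ (2) (arXiv:1407.1099v1 p. 4)] -/
theorem exists_units_zmod_ne_one_ne_neg_one_of_five_le (p : ℕ) [Fact p.Prime] (hp : 5 ≤ p) :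
    ∃ u : (ZMod p)ˣ, u ≠ 1 ∧ u ≠ -1 := by
  have hcop : Nat.Coprime 2 p :=
    (Nat.coprime_primes Nat.prime_two (Fact.out : p.Prime)).2 (by omega)
  have h3 : ((3 : ℕ) : ZMod p) ≠ 0 := by
    rw [Ne, ZMod.natCast_eq_zero_iff]
    intro h
    have := Nat.le_of_dvd (by norm_num) h
    omega
  refine ⟨ZMod.unitOfCoprime 2 hcop, ?_, ?_⟩
  · intro h
    have h' := congrArg (fun x : (ZMod p)ˣ => (x : ZMod p)) h
    simp only [ZMod.coe_unitOfCoprime, Nat.cast_ofNat, Units.val_one] at h'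
    exact one_ne_zero (by linear_combination h' : (1 : ZMod p) = 0)
  · intro h
    have h' := congrArg (fun x : (ZMod p)ˣ => (x : ZMod p)) h
    simp only [ZMod.coe_unitOfCoprime, Nat.cast_ofNat, Units.val_neg, Units.val_one] at h'
    apply h3
    have : (3 : ZMod p) = 0 := by linear_combination h'
    exact_mod_cast this

/-! ### `χ̄₃ = χ̄₃⁻¹`: Fouquet–Wan's (HypTW) at a multiplicative prime `3` -/

/-- Every unit of `𝔽₃` is its own inverse. [folklore] -/
private theorem units_zmod_three_inv_eq_self (u : (ZMod 3)ˣ) : u⁻¹ = u := by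
  revert u
  decide

/-- **The mod-`3` cyclotomic character equals its own inverse** — on the absolute Galois group of ANY
field `K` with `3 ≠ 0` in `K` (so for `K = ℚ` and for `K = ℚ₃`, whose absolute Galois group is the
decomposition group at `3`): `χ̄₃(σ)⁻¹ = χ̄₃(σ)` since `χ̄₃` is valued in `𝔽₃^× = {±1}`.
Consequence recorded for the cell (dictionary, not formalised here): for `E/ℚ` with multiplicative
reduction at `3`, `E[3]|_{G_{ℚ₃}}` is an extension of `ψ̄` by `ψ̄χ̄₃` (Tate), the quotient character
of Fouquet–Wan's Assumption 2.1 (HypTW) is `χ₁⁻¹χ₂ = χ̄₃⁻¹ = χ̄₃ ∈ {1, χ̄_cyc}`, and (HypTW) —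
standing in their §§2–5 — fails; at `p ≥ 5` it does not fail for this reason
(`exists_modPCyclotomicCharacterZMod_inv_ne_self_of_five_le`).
[cite: FouquetWan2021, Assumption 2.1 (HypTW), second item (arXiv:2107.13726v3 §2.2.2)] -/
theorem modPCyclotomicCharacterZMod_three_inv_eq_self (K : Type*) [Field K] [NeZero ((3 : ℕ) : K)]
    (σ : Field.absoluteGaloisGroup K) :
    (modPCyclotomicCharacterZMod K 3 σ)⁻¹ = modPCyclotomicCharacterZMod K 3 σ :=
  units_zmod_three_inv_eq_self _

/-- The same, as an identity of characters: `χ̄₃⁻¹ = χ̄₃` (pointwise inverse in the commutative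
group of `(ZMod 3)ˣ`-valued homomorphisms).
[cite: FouquetWan2021, Assumption 2.1 (HypTW), second item (arXiv:2107.13726v3 §2.2.2)] -/
theorem modPCyclotomicCharacterZMod_three_inv (K : Type*) [Field K] [NeZero ((3 : ℕ) : K)] :
    (modPCyclotomicCharacterZMod K 3)⁻¹ = modPCyclotomicCharacterZMod K 3 :=
  MonoidHom.ext fun σ => by
    rw [MonoidHom.inv_apply]
    exact modPCyclotomicCharacterZMod_three_inv_eq_self K σ

/-- For a prime `p ≥ 5`, a unit of `𝔽_p` that is NOT its own inverse exists (`2`: `2·2 = 4 ≠ 1`).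
[folklore] -/
private theorem exists_units_zmod_inv_ne_self_of_five_le (p : ℕ) [Fact p.Prime] (hp : 5 ≤ p) :
    ∃ u : (ZMod p)ˣ, u⁻¹ ≠ u := by
  have hcop : Nat.Coprime 2 p :=
    (Nat.coprime_primes Nat.prime_two (Fact.out : p.Prime)).2 (by omega)
  refine ⟨ZMod.unitOfCoprime 2 hcop, fun h => ?_⟩
  have hmul : (ZMod.unitOfCoprime 2 hcop) * (ZMod.unitOfCoprime 2 hcop) = 1 := by
    nth_rewrite 1 [← h]
    exact inv_mul_cancel _
  have h' := congrArg (fun x : (ZMod p)ˣ => (x : ZMod p)) hmul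
  simp only [Units.val_mul, ZMod.coe_unitOfCoprime, Nat.cast_ofNat, Units.val_one] at h'
  have h3 : ((3 : ℕ) : ZMod p) = 0 := by
    have : (3 : ZMod p) = 0 := by linear_combination h'
    exact_mod_cast this
  rw [ZMod.natCast_eq_zero_iff] at h3
  have := Nat.le_of_dvd (by norm_num) h3
  omega

/-- **Contrast at `p ≥ 5` over `ℚ`**: the mod-`p` cyclotomic character of `ℚ` is onto `𝔽_p^×`
(tree theorem `modPCyclotomicCharacterZMod_rat_surjective`, Serre 1972 §5.2 (iii)), so some
`σ ∈ Γ_ℚ` has `χ̄_p(σ)⁻¹ ≠ χ̄_p(σ)`: the identity `χ̄_p = χ̄_p⁻¹` that voids (HypTW) at a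
multiplicative `3` is special to `p ∈ {2, 3}`. (The local version at `G_{ℚ_p}` — `χ̄_p|_{G_{ℚ_p}}`
is onto as well, `ℚ_p(ζ_p)/ℚ_p` being totally ramified of degree `p − 1` — is not formalised here.)
[cite: FouquetWan2021, Assumption 2.1 (HypTW) (arXiv:2107.13726v3 §2.2.2)]
[cite: Serre1972, §5.2 (iii)] -/
theorem exists_modPCyclotomicCharacterZMod_inv_ne_self_of_five_le (p : ℕ) [Fact p.Prime]
    (hp : 5 ≤ p) :
    ∃ σ : Field.absoluteGaloisGroup ℚ,
      (modPCyclotomicCharacterZMod ℚ p σ)⁻¹ ≠ modPCyclotomicCharacterZMod ℚ p σ := by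
  haveI : NeZero ((p : ℕ) : ℚ) := ⟨by exact_mod_cast (Fact.out : p.Prime).ne_zero⟩
  obtain ⟨u, hu⟩ := exists_units_zmod_inv_ne_self_of_five_le p hp
  obtain ⟨σ, hσ⟩ := modPCyclotomicCharacterZMod_rat_surjective p u
  exact ⟨σ, by rwa [hσ]⟩

/-! ### No tame pair at `3`: Eischen–Wan 2016 §4.3's "`τ₁, τ₂, τ₁τ₂` all have conductor `(p)`"

Eischen–Wan, J. Inst. Math. Jussieu 15 (2016) 471–510 [EischenWan2016] (arXiv:1404.7153), whose main
theorem is Fouquet–Wan's Proposition 7.19 ("just a translation of the main theorem of [EischenWan]",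
arXiv:2107.13726v3 App. B §7.4.1), do ALL their `p`-adic computations under a TAME datum at `p`:
§4.3 "Let `τ_p = (τ₁, τ₂)` be a character of `𝒦_p^× = ℚ_p^× × ℚ_p^×` … Suppose `(τ₁τ₂)` has conductor
`p`"; Prop. 4.8 "Let `τ₁, τ₂` be two characters of `ℚ_p^×` with conductor `(p)` such that
`cond(τ₁τ₂) = (p)` as well"; §4.3.2 "Suppose `τ_p = (τ₁, τ₂)` is such that each of `τ₁`, `τ₂`, and
`τ₁τ₂` has conductor `(p)`"; and the interpolation set of Theorem 1.2 (i)–(iii) is `𝒳^{pb}` (§5.1):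
the arithmetic points `φ` "such that the `τ_φ` … `τ_φ = (τ₁, τ₂)` …, we have `τ₁`, `τ₂`, `τ₁τ₂` all
have conductor `(p)`" ("We will use the points in `𝒳^{pb}` for `p`-adic interpolation of special
`L`-values and Klingen Eisenstein series", Rem. 5.1; §5.4.3, Thm. 5.8 and Cor. 5.9 = Thm. 1.2 (iii) are
stated "for `φ ∈ 𝒳^{pb}`"). A character of `ℚ_p^×` has conductor exactly `(p)` iff its restriction to
`ℤ_p^×` factors through a NON-TRIVIAL character of `(ℤ_p/p)^× = 𝔽_p^×`; so the datum asks for two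
non-trivial characters `τ̄₁, τ̄₂` of `𝔽_p^×` whose product is non-trivial. At `p ≥ 5` take
`τ̄₁ = τ̄₂` of order `≥ 3`. AT `p = 3`, `𝔽₃^× = {±1}` has exactly one non-trivial character (values
`±1` in any domain), and the product of two non-trivial ones is trivial: the datum does not exist, the
set `𝒳^{pb}` is EMPTY, and Theorem 1.2 (i)–(iii) of [EischenWan2016] — hence [FouquetWan2021]
Prop. 7.19 (i)–(iii), whose standing line "`κ ≡ 0 (mod 2(p−1))` … the `p`-adic avatar of
`ξ₀' = ξ₀·(ε⁻¹∘Nm)` factors through `Γ_𝒦`" is the same tame bookkeeping as Wan, ANT 14 (2020)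
Thm. 1.1's "`ξ|_{𝔸_ℚ^×} = ω∘Nm`, `κ ≡ 0 (mod p−1)` … `p ≥ 5`" — have NO PRINTED PROOF at `p = 3`:
the source statement they translate is vacuous there (the `Λ`-adic objects are defined from the
Siegel–Eisenstein measure, but no interpolation property and no constant-term divisibility —
Thm. 1.2 (iii), the Eisenstein-congruence input of [FouquetWan2021] Thm. 7.32 — is established for
them at `3`). Wan's own gloss (ANT 9 (2015)
p. 1957): the nearly-ordinary "generic case" (Def. 4.21: strictly separated conductor EXPONENTS
`t₁ > t₂ > ⋯ > s₂`, wild characters — plentiful at every `p`) needs the form RAMIFIED at `p`, i.e. a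
Hida family; "for a single form unramified at `p` (not necessarily ordinary)" one uses [Eischen and
Wan 2014] = [EischenWan2016] — the tame version recorded here. This is the third printed threshold of
the X11b-at-`3` literature that is an ARITHMETIC identity at `3` (`𝔽₃^× = {±1}`) rather than a
convention; like the other two it constrains the auxiliary datum of a METHOD, not the statement.
The theorems below are the finite-group core (characters of `(ZMod 3)ˣ`, resp. Dirichlet characters
of level `3` and their conductors); the dictionary "conductor exactly `(p)` ⟺ non-trivial on `𝔽_p^×`
and trivial on `1 + pℤ_p`" is standard and not formalised here. Seat report:
HOME/b2b-bsdres-x11b3-lit2/LIT-TABLE-K.md §11. -/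

/-- A non-trivial multiplicative character of `𝔽₃` with values in a domain takes the value `−1` at
`−1` (its square is `χ(1) = 1`, and `χ` is determined by this value since `𝔽₃^× = {±1}`). [folklore] -/
private theorem mulChar_zmod_three_neg_one_of_ne_one {R : Type*} [CommRing R] [IsDomain R]
    (χ : MulChar (ZMod 3) R) (hχ : χ ≠ 1) : χ (-1) = -1 := by
  obtain ⟨a, ha⟩ := MulChar.ne_one_iff.mp hχ
  have hsq : χ (-1) * χ (-1) = 1 := by
    rw [← map_mul]
    have : ((-1 : ZMod 3) * (-1 : ZMod 3)) = 1 := by decide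
    rw [this, MulChar.map_one]
  rcases mul_self_eq_one_iff.mp hsq with h | h
  · exfalso
    rcases units_zmod_three_eq_one_or_eq_neg_one a with rfl | rfl
    · exact ha (by rw [Units.val_one, MulChar.map_one])
    · exact ha (by rw [Units.val_neg, Units.val_one, h])
  · exact h

/-- **No tame pair at `3` (Eischen–Wan 2016, §4.3 / Prop. 4.8 / the set `𝒳^{pb}` of §5.1).** Two
non-trivial multiplicative characters of `𝔽₃` (values in any domain) have TRIVIAL product. With the
standard dictionary (a character of `ℚ₃^×` has conductor exactly `(3)` iff it is a non-trivial
character of `𝔽₃^×` on `ℤ₃^×`), the standing datum "`τ₁, τ₂, τ₁τ₂` all of conductor `(p)`" of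
[EischenWan2016] does not exist at `p = 3`, so its Theorem 1.2 is vacuous there as printed, and
[FouquetWan2021] Prop. 7.19 ("a translation of the main theorem of [EischenWan]") has no printed
proof at `3`. Group-theoretic core only.
[cite: EischenWan2016, §4.3 (standing hypothesis), Prop. 4.8, §4.3.2, §5.1 (definition of `𝒳^{pb}`), Rem. 5.1 (arXiv:1404.7153)]
[cite: FouquetWan2021, App. B Prop. 7.19 and the paragraph before it (arXiv:2107.13726v3 §7.4.1)] -/
theorem mulChar_zmod_three_mul_eq_one_of_ne_one {R : Type*} [CommRing R] [IsDomain R]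
    (χ ψ : MulChar (ZMod 3) R) (hχ : χ ≠ 1) (hψ : ψ ≠ 1) : χ * ψ = 1 := by
  refine MulChar.ext fun a => ?_
  rw [MulChar.mul_apply, MulChar.one_apply_coe]
  rcases units_zmod_three_eq_one_or_eq_neg_one a with rfl | rfl
  · rw [Units.val_one, MulChar.map_one, MulChar.map_one, one_mul]
  · rw [Units.val_neg, Units.val_one, mulChar_zmod_three_neg_one_of_ne_one χ hχ,
      mulChar_zmod_three_neg_one_of_ne_one ψ hψ]
    ring

/-- The same in the language of Dirichlet characters of level `3` and their CONDUCTORS (Mathlib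
`DirichletCharacter.conductor`): there is no pair `χ, ψ` mod `3` with `χ`, `ψ` and `χψ` all of
conductor `3` — the finite-level form of Eischen–Wan's "`τ₁, τ₂, τ₁τ₂` all have conductor `(p)`" at
`p = 3`. Values in any domain (e.g. `ℂ`, `ℚ̄_p`).
[cite: EischenWan2016, Prop. 4.8 and §5.1 (definition of `𝒳^{pb}`) (arXiv:1404.7153)] -/
theorem not_exists_dirichletCharacter_three_conductor_pair {R : Type*} [CommRing R] [IsDomain R] :
    ¬ ∃ χ ψ : DirichletCharacter R 3,
      χ.conductor = 3 ∧ ψ.conductor = 3 ∧ (χ * ψ).conductor = 3 := by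
  rintro ⟨χ, ψ, hχ, hψ, hχψ⟩
  have hχ1 : χ ≠ 1 := fun h => by
    rw [(DirichletCharacter.eq_one_iff_conductor_eq_one).mp h] at hχ
    exact absurd hχ (by decide)
  have hψ1 : ψ ≠ 1 := fun h => by
    rw [(DirichletCharacter.eq_one_iff_conductor_eq_one).mp h] at hψ
    exact absurd hψ (by decide)
  rw [mulChar_zmod_three_mul_eq_one_of_ne_one χ ψ hχ1 hψ1, DirichletCharacter.conductor_one] at hχψ
  exact absurd hχψ (by decide)

/-- For a prime level `p`, a Dirichlet character mod `p` has conductor `p` iff it is non-trivial.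
[folklore] -/
private theorem conductor_eq_of_ne_one_of_prime {R : Type*} [CommRing R] (p : ℕ) [Fact p.Prime]
    (χ : DirichletCharacter R p) (hχ : χ ≠ 1) : χ.conductor = p := by
  rcases (Fact.out : p.Prime).eq_one_or_self_of_dvd _ (DirichletCharacter.conductor_dvd_level χ)
    with h | h
  · exact absurd ((DirichletCharacter.eq_one_iff_conductor_eq_one).mpr h) hχ
  · exact h

/-- **Contrast at `p ≥ 5`**: the tautological character `𝔽_p^× → 𝔽_p^×` (the reduction of the
Teichmüller character) and its square are both non-trivial, i.e. both of conductor `p` — so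
Eischen–Wan's tame datum "`τ₁ = τ₂ = ω`, `τ₁τ₂ = ω²`, all of conductor `(p)`" exists for every prime
`p ≥ 5`, exactly as used with "`κ ≡ 0 (mod p−1)`, `ξ|_{𝔸_ℚ^×} = ω∘Nm`, `p ≥ 5`" in Wan, ANT 14
(2020) Thm. 1.1. (Witness unit: any `u ≠ ±1`, e.g. `2`, from
`exists_units_zmod_ne_one_ne_neg_one_of_five_le`.)
[cite: EischenWan2016, Prop. 4.8 (arXiv:1404.7153)]
[cite: Wan2020, Thm. 1.1 (arXiv:1408.4044, ANT 14 (2020) 383–483)] -/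
theorem exists_dirichletCharacter_conductor_pair_of_five_le (p : ℕ) [Fact p.Prime] (hp : 5 ≤ p) :
    ∃ χ : DirichletCharacter (ZMod p) p, χ.conductor = p ∧ (χ * χ).conductor = p := by
  obtain ⟨u, hu1, hu2⟩ := exists_units_zmod_ne_one_ne_neg_one_of_five_le p hp
  let χ : DirichletCharacter (ZMod p) p := MulChar.ofUnitHom (MonoidHom.id (ZMod p)ˣ)
  have hχu : χ u = (u : ZMod p) := by
    show MulChar.ofUnitHom (MonoidHom.id (ZMod p)ˣ) (u : ZMod p) = (u : ZMod p)
    rw [MulChar.ofUnitHom_coe, MonoidHom.id_apply]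
  have hχ : χ ≠ 1 := MulChar.ne_one_iff.mpr ⟨u, by
    rw [hχu]
    exact fun h => hu1 (Units.val_eq_one.mp h)⟩
  have hχχ : χ * χ ≠ 1 := MulChar.ne_one_iff.mpr ⟨u, by
    rw [MulChar.mul_apply, hχu]
    intro h
    rcases mul_self_eq_one_iff.mp h with h' | h'
    · exact hu1 (Units.val_eq_one.mp h')
    · exact hu2 (Units.ext (by rw [h', Units.val_neg, Units.val_one]))⟩
  exact ⟨χ, conductor_eq_of_ne_one_of_prime p χ hχ, conductor_eq_of_ne_one_of_prime p (χ * χ) hχχ⟩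

end Literature.NumberTheory.EllipticCurves.Rank1Residual.X11Three
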